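/-
Copyright: pub-balaban β-flow team, β-FLOW PROVER 4 (unit `b2b-balaban-beta-bflow-p4`, gen 12; coordinator ruling «YM
ACCELERATION» 2026-08-21 item (2), «work behind the as-printed interface»).  NON-VACUITY WITNESS for PART 25a's binder family:
the ultralocal diagonal curvature kernel (the Maxwell form c·Σ_xΣ_{a<b}F_{ab}(x)²) with one domain per site meets the translation
reading `htr`, the plaquette reflection covariance (R) and the diagonal permutation covariance (P) of `hcov_of_reflection_perm`,
with constant c for ANY real c.  An explicit toy; nothing of Bałaban's asserted; NOT BetaPertH, NOT continuum, NOT Clay.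
-/
import Mathlib
import Literature.MathematicalPhysics.QuantumFieldTheory.Balaban1983to89.B7Prop1Explicit
import Literature.MathematicalPhysics.QuantumFieldTheory.Balaban1983to89.Beta.PolarizationSign
import Summits.QuantumFields.BalabanUV.Beta.EriceCurvatureFormCovariance

/-!
# `Beta.EriceCurvatureFormCovarianceWitness` — PART 25d of the `EriceLoopExpansionD4` series: the binders of PART 25a's
# `hcov_of_reflection_perm` are inhabited (c ≠ 0 allowed)

Source: T. Bałaban, A. Jaffe, *Constructive gauge theory* (Erice 1985) [BalabanJaffe1986], Part III p. 249 (3.65); T. Bałaban,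
Commun. Math. Phys. **109** (1987) [Balaban1987RG1] (5.6)–(5.8) pp. 292–293, (1.21) p. 264; this lineage's PART 25a
`EriceCurvatureFormCovariance` (binders `htr`, `hRk` = (R), `hPk` = (P); `hcov_of_reflection_perm`), in the style of the lineage's
earlier witnesses (gen 7 PART 17d, gen 9 PART 21e, gen 10 PART 22b `hypotheses_inhabited`).

THE WITNESS.  Sites S ⊂ ℤ^d (any finite set); one domain per site: 𝒳 := ℤ^d, D := S, P_X := {X}; per-domain kernel
K_X((x,o),(x′,o′)) := c·[x = X]·[x′ = X]·[o = o′] on sorted orientation pairs; summed kernel k₀(o,o′,w) := c·[o = o′]·[o sorted]·[w = 0]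
— the curvature form c·Σ_{x}Σ_{a<b} F_{(x,(a,b))}F′_{(x,(a,b))}, i.e. c times the Maxwell form ½Σ_xΣ_{a≠b}F_{ab}F′_{ab}.  For this
family `htr` holds (at x ∈ S the summed domain kernel is c·[o=o′]·[x′ = x] = k₀(o,o′,x−x′)), (R) holds for every axis (for o ≠ o′ both
members vanish; for o = o′ the two shifts cancel, εw = 0 iff w = 0, and the sign is a square), (P) holds (w∘σ⁻¹ = 0 iff w = 0), and
the constant of the derived `hcov` is Σ_w k₀(o₀,o₀,w) = c.

WHAT IS KERNEL-CHECKED HERE (def-free; an explicit toy + composition BY NAME):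
* §1 `axisReflect_eq_zero_iff`, **`ultralocal_R`**, **`ultralocal_P`**.
* §2 **`hypotheses_inhabited`** — ∃ K k with `htr` ∧ (R) ∧ (P) ∧ (PART 25a's derived `hcov` with constant Σ_w k(o₀,o₀,w)) ∧ that constant = c.
HONEST: a toy (the free Maxwell curvature form), NOT Bałaban's summed Hessian; it shows only that PART 25a's hypotheses are
jointly satisfiable with a non-zero constant (no hidden «c = 0» or «False»); nothing of Bałaban's 𝓔^{(j)} ∕ Π^{(j)} asserted;
NOT N5 for the model, NOT (3.36), NOT B12 Thm 2, NOT BetaPertH, NOT continuum, NOT Clay.  HONEST DEPENDENCY: continuum YM on T⁴ ⇐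
BetaPertH ∧ nine spine estimates (0/9 proved); BetaPertH ⇐ (D1) ∧ (D4) ∧ CAP+tail; G-an2-4 gates asym, D1 and NE2/3/4.
-/

namespace Summit.QuantumFields.BalabanUV.Beta.EriceCurvatureFormCovarianceWitness

open scoped BigOperators
open Finset
open Literature.MathematicalPhysics.QuantumFieldTheory.Balaban1983to89
open Literature.MathematicalPhysics.QuantumFieldTheory.Balaban1983to89.B7Prop1Explicit (e e_apply)
open Literature.MathematicalPhysics.QuantumFieldTheory.Balaban1983to89.Beta.PolarizationSign
  (axisReflect axisReflect_apply axisReflect_axisReflect reflSign)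
open Summit.QuantumFields.BalabanUV.Beta.EriceCurvatureFormCovariance
  (reflSign_eq hcov_of_reflection_perm zerothMoment_offDiag_eq_zero)

variable {d : ℕ}

/-! ## §1. The ultralocal diagonal curvature kernel (the Maxwell form c·Σ_x Σ_{a<b} F_{ab}(x)²) obeys (R) and (P) -/

/-- ε is injective on ℤ^d: εw = 0 iff w = 0. [folklore] -/
theorem axisReflect_eq_zero_iff (α : Fin d) (w : Fin d → ℤ) : axisReflect α w = 0 ↔ w = 0 := by
  constructor
  · intro h
    have := congrArg (axisReflect α) h
    rw [axisReflect_axisReflect] at this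
    rw [this]; funext i; by_cases hi : i = α <;> simp [hi]
  · intro h; rw [h]; funext i; by_cases hi : i = α <;> simp [hi]

/-- **(R) for the ultralocal diagonal kernel** k₀(o,o′,w) = c·[o = o′]·[o sorted]·[w = 0]: PART 25a's plaquette reflection
covariance holds for every axis (for o ≠ o′ both members vanish; for o = o′ the shifts cancel, the argument is εw, and εw = 0 iff
w = 0; the sign is a square). [folklore] -/
theorem ultralocal_R (c : ℝ) (α : Fin d) (o o' : Fin d × Fin d) (w : Fin d → ℤ) :
    (if o = o' ∧ o.1 < o.2 ∧ (axisReflect α w - (if α = o.1 ∨ α = o.2 then e α else 0)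
        + (if α = o'.1 ∨ α = o'.2 then e α else 0)) = 0 then c else 0)
      = (reflSign α o.1 * reflSign α o.2) * (reflSign α o'.1 * reflSign α o'.2)
        * (if o = o' ∧ o.1 < o.2 ∧ w = 0 then c else 0) := by
  by_cases hoo : o = o'
  · subst hoo
    have hsq : (reflSign α o.1 * reflSign α o.2) * (reflSign α o.1 * reflSign α o.2) = 1 := by
      simp only [reflSign_eq]; split_ifs <;> norm_num
    rw [hsq, one_mul, sub_add_cancel]
    simp only [true_and, axisReflect_eq_zero_iff]
  · have h1 : ¬ (o = o' ∧ o.1 < o.2 ∧ (axisReflect α w - (if α = o.1 ∨ α = o.2 then e α else 0)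
        + (if α = o'.1 ∨ α = o'.2 then e α else 0)) = 0) := fun h => hoo h.1
    have h2 : ¬ (o = o' ∧ o.1 < o.2 ∧ w = 0) := fun h => hoo h.1
    rw [if_neg h1, if_neg h2, mul_zero]

/-- **(P) for the ultralocal diagonal kernel**: the diagonal axis-permutation covariance of PART 25a (w∘σ⁻¹ = 0 iff w = 0). [folklore] -/
theorem ultralocal_P (c : ℝ) (σ : Equiv.Perm (Fin d)) (a b : Fin d) (w : Fin d → ℤ) (hab : a < b) (hσ : σ a < σ b) :
    (if ((σ a, σ b) = (σ a, σ b) ∧ (σ a, σ b).1 < (σ a, σ b).2 ∧ (w ∘ σ.symm) = 0) then c else 0)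
      = (if ((a, b) = (a, b) ∧ (a, b).1 < (a, b).2 ∧ w = 0) then c else 0) := by
  have hiff : (w ∘ σ.symm) = 0 ↔ w = 0 := by
    constructor
    · intro h; funext i
      have := congrFun h (σ i)
      simpa using this
    · intro h; rw [h]; rfl
  simp only [true_and, hσ, hab, hiff]

/-! ## §2. The binders of `hcov_of_reflection_perm` are inhabited, with c ≠ 0 -/

/-- **NON-VACUITY OF PART 25a's BINDER FAMILY.**  On any finite site set S ⊂ ℤ^d take one domain per site (𝒳 := sites, D := S,
P_X := {X}) with the per-domain kernel K_X((x,o),(x′,o′)) = c·[x = X]·[x′ = X]·[o = o′] on sorted orientation pairs, and the summed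
kernel k₀(o,o′,w) = c·[o = o′]·[o sorted]·[w = 0] (the Maxwell form c·Σ_x Σ_{a<b} F_{ab}(x)²).  THEN the translation reading `htr`,
the plaquette reflection covariance (R) and the diagonal permutation covariance (P) of PART 25a's `hcov_of_reflection_perm` ALL hold,
and the derived `hcov` has the constant Σ_w k₀(o₀,o₀,w) = c — any real c, in particular c ≠ 0: the binder family is not vacuous and
does not force c = 0. [folklore] -/
theorem hypotheses_inhabited (c : ℝ) (S : Finset (Fin d → ℤ)) (o₀ : Fin d × Fin d) (ho₀ : o₀.1 < o₀.2) :
    ∃ (K : (Fin d → ℤ) → (Fin d → ℤ) × {o : Fin d × Fin d // o.1 < o.2} → (Fin d → ℤ) × {o : Fin d × Fin d // o.1 < o.2} → ℝ)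
      (k : Fin d × Fin d → Fin d × Fin d → (Fin d → ℤ) → ℝ),
      (∀ x ∈ S, ∀ (o o' : {o : Fin d × Fin d // o.1 < o.2}) (x' : Fin d → ℤ),
        (∑ X ∈ S, if x' ∈ ({X} : Finset (Fin d → ℤ)) then K X (x, o) (x', o') else 0) = k o.1 o'.1 (x - x'))
      ∧ (∀ (α : Fin d) (o o' : Fin d × Fin d) (w : Fin d → ℤ),
        k o o' (axisReflect α w - (if α = o.1 ∨ α = o.2 then e α else 0) + (if α = o'.1 ∨ α = o'.2 then e α else 0))
          = (reflSign α o.1 * reflSign α o.2) * (reflSign α o'.1 * reflSign α o'.2) * k o o' w)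
      ∧ (∀ (σ : Equiv.Perm (Fin d)) (a b : Fin d) (w : Fin d → ℤ), a < b → σ a < σ b →
        k (σ a, σ b) (σ a, σ b) (w ∘ σ.symm) = k (a, b) (a, b) w)
      ∧ (∀ x ∈ S, ∀ o o', ∑ X ∈ S, ∑ x' ∈ ({X} : Finset (Fin d → ℤ)), K X (x, o) (x', o')
          = if o = o' then ∑' w, k o₀ o₀ w else 0)
      ∧ (∑' w, k o₀ o₀ w) = c := by
  classical
  -- the translation reading for the one-domain-per-site family
  have htr : ∀ x ∈ S, ∀ (o o' : {o : Fin d × Fin d // o.1 < o.2}) (x' : Fin d → ℤ),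
      (∑ X ∈ S, if x' ∈ ({X} : Finset (Fin d → ℤ)) then
          (if ((x, o) : (Fin d → ℤ) × {o : Fin d × Fin d // o.1 < o.2}).1 = X ∧
              ((x', o') : (Fin d → ℤ) × {o : Fin d × Fin d // o.1 < o.2}).1 = X ∧
              ((x, o) : (Fin d → ℤ) × {o : Fin d × Fin d // o.1 < o.2}).2 = (x', o').2 then c else 0) else 0)
        = if (o.1 = o'.1 ∧ o.1.1 < o.1.2 ∧ x - x' = 0) then c else 0 := by
    intro x hx o o' x'
    simp only
    by_cases hxx : x' = x
    · subst hxx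
      rw [Finset.sum_eq_single x']
      · simp only [Finset.mem_singleton, if_true, true_and, sub_self]
        by_cases hoo : o = o'
        · subst hoo; simp [o.2]
        · have : ¬ (o.1 = o'.1) := fun h => hoo (Subtype.ext h)
          simp [hoo, this]
      · intro X _ hX
        have : x' ∉ ({X} : Finset (Fin d → ℤ)) := fun h => hX (Finset.mem_singleton.mp h).symm
        rw [if_neg this]
      · intro h; exact absurd hx h
    · have hR : (if (o.1 = o'.1 ∧ o.1.1 < o.1.2 ∧ x - x' = 0) then c else 0) = 0 := by
        have : ¬ (x - x' = 0) := fun h => hxx (sub_eq_zero.mp h).symm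
        simp [this]
      rw [hR]
      refine Finset.sum_eq_zero fun X _ => ?_
      split_ifs with h1 h2
      · exfalso
        rw [Finset.mem_singleton] at h1
        exact hxx (h1.trans h2.1.symm)
      · rfl
      · rfl
  have hc : ∑' w : Fin d → ℤ, (if (o₀ = o₀ ∧ o₀.1 < o₀.2 ∧ w = 0) then c else 0) = c := by
    rw [tsum_eq_single 0]
    · simp [ho₀]
    · intro w hw; simp [hw]
  refine ⟨fun X p q => if p.1 = X ∧ q.1 = X ∧ p.2 = q.2 then c else 0,
    fun o o' w => if o = o' ∧ o.1 < o.2 ∧ w = 0 then c else 0, htr,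
    fun α o o' w => ultralocal_R c α o o' w, fun σ a b w hab hσ => ultralocal_P c σ a b w hab hσ, ?_, hc⟩
  -- hcov through PART 25a
  exact hcov_of_reflection_perm (d := d) S S (fun X => ({X} : Finset (Fin d → ℤ)))
    (fun X p q => if p.1 = X ∧ q.1 = X ∧ p.2 = q.2 then c else 0)
    (fun o o' w => if o = o' ∧ o.1 < o.2 ∧ w = 0 then c else 0) htr (fun α o o' w => ultralocal_R c α o o' w)
    (fun σ a b w hab hσ => ultralocal_P c σ a b w hab hσ) o₀ ho₀

end Summit.QuantumFields.BalabanUV.Beta.EriceCurvatureFormCovarianceWitness
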